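import Mathlib
import HarnessLib
import Summits.HubbardSuperconductivity.HubbardSuperconductivity.Theorems.KLProgrammeKLRegimeCountertermJacksonRemainderCertFrameDefs

/-!
# (C1) CUTOFF-DEFECT CERTIFICATE — the table of record for Jackson degree `d = 512` (`n + 1 = 2`)

Seat hubbard-kl-k3c3-p1 (g7), stmt-HubbardSuperconductivity-20437 stub (C).  `klC1TableF512 : CutoffDefectTable` = entrywise maxima over 22464 parameter
boxes (kit engine A, outward-rounded interval arithmetic; evidence `C1-CERT.md` + job manifests on 20437) of the 27 kernel moments of
`CutoffDefectCertFrame 512 klC1FrameAF512 klC1TableF512`, each rounded UP to 4 significant digits.  The hypothesis itself is NOT proved here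
(named numerical hypothesis, KLCert pattern); this file only fixes the numbers the consumer `flowPiece_reading_remainder_jets_of_cert` reads.
Sources: kit jobs j288425 (production, 14400 boxes 2π/320 × 0.02) + j289077, j289463 (refinement of the 616 resp. 416 worst boxes to 0.01 resp. 0.0025), merged per leaf box (merged-F512b.json).
-/

noncomputable section

namespace Summit.HubbardSuperconductivity.HubbardSuperconductivity.Theorems.KLRegimeSplit

set_option linter.dupNamespace false -- summit = problem name (single-conjunct summit), D-0017

/-- Frame sizes `A j ≥ ‖Dʲ(evalM K′)‖_∞` (`j ≤ 4`) of the FRAME-quantified `d = 512` certificate (`CutoffDefectCertFrame`). -/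
def klC1FrameAF512 : ℕ → ℝ := fun j =>
  match j with
  | 0 => 0.000000000001
  | 1 => 0.000000000001
  | 2 => 0.000000000001
  | 3 => 0.000000000001
  | 4 => 0.000000000001
  | _ => 0

/-- **The certified kernel-moment table for `d = 512`** (upper bounds, 4 significant digits, rounded up). -/
def klC1TableF512 : CutoffDefectTable where
  N0 := 0.0003057
  N := fun i =>
    match i with
    | 1 => 0.0007804
    | 2 => 0.01699
    | 3 => 2.432
    | 4 => 1489
    | _ => 0
  Mc := fun k i l =>
    match k, i, l with
    | 2, 1, 1 => 0.0007807
    | 3, 1, 1 => 0.00002186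
    | 3, 1, 2 => 0.0007813
    | 3, 2, 1 => 0.01685
    | 4, 1, 1 => 0.0002648
    | 4, 1, 2 => 0.00006516
    | 4, 1, 3 => 0.000782
    | 4, 2, 1 => 0.00265
    | 4, 2, 2 => 0.01675
    | 4, 3, 1 => 2.344
    | _, _, _ => 0
  Tt := fun k l =>
    match k, l with
    | 2, 1 => 0.007831
    | 3, 1 => 0.09546
    | 3, 2 => 0.02352
    | 4, 1 => 2.574
    | 4, 2 => 0.3823
    | 4, 3 => 0.04704
    | _, _ => 0
  Tu := fun k =>
    match k with
    | 1 => 0.002093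
    | 2 => 0.004191
    | 3 => 0.006294
    | 4 => 0.008403
    | _ => 0
  Td := 0.002015

/-- Evaluation pattern (for the closer): the natural-profile (`a_l = 4ˡ`) order-4 value of the linear form, `T.bound (4^·) 4 ≤ 1554`
(i.e. `ρ₄ ≤ 6.07`): rewrite the finite index sets, then `norm_num`. -/
theorem klC1TableF512_natural_four : klC1TableF512.bound (fun l => (4 : ℝ) ^ l) 4 ≤ 1554 := by
  have e1 : Finset.Icc 1 (4 - 1) = {1, 2, 3} := by decide
  have e2 : Finset.Icc 1 (4 - 2) = {1, 2} := by decide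
  have e3 : Finset.Icc 1 (4 - 3) = {1} := by decide
  have e4 : Finset.Ico 1 4 = {1, 2, 3} := by decide
  rw [CutoffDefectTable.bound, e4, Finset.sum_insert (by decide), Finset.sum_insert (by decide), Finset.sum_singleton, e1, e2, e3,
    Finset.sum_insert (by decide), Finset.sum_insert (by decide), Finset.sum_singleton, Finset.sum_insert (by decide), Finset.sum_singleton,
    Finset.sum_singleton, Finset.sum_insert (by decide), Finset.sum_insert (by decide), Finset.sum_singleton]
  norm_num [klC1TableF512, Nat.choose]

end Summit.HubbardSuperconductivity.HubbardSuperconductivity.Theorems.KLRegimeSplit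

end
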